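import Summits.CriticalPhenomena.CardyFormulaZ2.Theorems.StripClusterRates.Negative.RateWindow

/-!
# `StripClusterRates` (stmt-CriticalPhenomena-13878), line `two-cluster-rate-is-stationary-gap`:
# the unconditional lower edge `3 log 2 ≤ lim n·γ₂(n)` from the BK–Reimer three-arm bound

Stub `arm_nMul_rateTwo_limit_ge_three_log_two` of the BK–Reimer three-arm bound for the
two-cluster event (lead c5). The three-arm bound gives `γ₂(n) ≥ 2γ₁(n) + γ₁(n-1)` for every width
`n ≥ 2` (taken as a hypothesis here; it is the content of the sibling stubs). Combined with the
tree's self-duality bound `γ₁(n) ≥ log 2/(n+2)` (`rateOne_ge`), for `n ≥ 2` one has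
`n·γ₂(n) ≥ n·(2 log 2/(n+2) + log 2/(n+1)) → 3 log 2`; so every limit `L₂` of `n·γ₂(n)` satisfies
`3 log 2 ≈ 2.079 ≤ L₂` (`arm_nMul_rateTwo_limit_ge_three_log_two`), improving the BK edge `2 log 2`
of `nMul_rateTwo_limit_ge`. The crux claims `L₂ = 2π ≈ 6.28`.
-/

noncomputable section

open MeasureTheory Filter Topology
open Literature.Probability.LatticeModels Literature.Probability.Percolation
open Summit.CriticalPhenomena.CardyFormulaZ2.Theorems.StripClusterRates.Negative

namespace Summit.CriticalPhenomena.CardyFormulaZ2.Cruxes.StripClusterRates.TwoClusterRateIsStationaryGap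

/-- The comparison sequence: `n · (2 log 2/(n+2) + log 2/(n+1)) → 3 log 2`. [folklore] -/
theorem arm5_tendsto_nMul_three_arm_lower :
    Tendsto (fun n : ℕ ↦ (n : ℝ) * (2 * (Real.log 2 / (n + 2)) + Real.log 2 / (n + 1))) atTop
      (𝓝 (3 * Real.log 2)) := by
  have h1 : Tendsto (fun n : ℕ ↦ 2 * Real.log 2 / (1 + 2 / (n : ℝ)) + Real.log 2 / (1 + 1 / (n : ℝ)))
      atTop (𝓝 (2 * Real.log 2 / (1 + 0) + Real.log 2 / (1 + 0))) := by
    refine (tendsto_const_nhds.div (tendsto_const_nhds.add ?_) (by norm_num)).add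
      (tendsto_const_nhds.div (tendsto_const_nhds.add ?_) (by norm_num))
    · exact tendsto_const_nhds.div_atTop tendsto_natCast_atTop_atTop
    · exact tendsto_const_nhds.div_atTop tendsto_natCast_atTop_atTop
  simp only [add_zero, div_one] at h1
  rw [show 2 * Real.log 2 + Real.log 2 = 3 * Real.log 2 by ring] at h1
  refine h1.congr' ?_
  filter_upwards [eventually_ge_atTop 1] with n hn
  have : (n : ℝ) ≠ 0 := by exact_mod_cast Nat.one_le_iff_ne_zero.mp hn
  field_simp

/-- **Lower edge of the window for the two-cluster constant, from the BK–Reimer three-arm bound**: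
if the rates `γ₁(n)` of `-log p₁(m,n)/m` exist for `n ≥ 1` and `γ₂(n) ≥ 2γ₁(n) + γ₁(n-1)` for all
`n ≥ 2`, then any limit `L₂` of `n·γ₂(n)` satisfies `3 log 2 ≤ L₂` (for `n ≥ 2`:
`n·γ₂(n) ≥ n·(2 log 2/(n+2) + log 2/(n+1)) → 3 log 2`, by the self-duality bound `rateOne_ge`
at widths `n` and `n-1`). [folklore] -/
theorem arm_nMul_rateTwo_limit_ge_three_log_two : ∀ γ₁ γ₂ : ℕ → ℝ, (∀ n : ℕ, 1 ≤ n → Tendsto (fun m : ℕ ↦ -Real.log (crossingProb half m n) / (m : ℝ)) atTop (𝓝 (γ₁ n))) → (∀ n : ℕ, 2 ≤ n → 2 * γ₁ n + γ₁ (n - 1) ≤ γ₂ n) → ∀ L₂ : ℝ, Tendsto (fun n : ℕ ↦ (n : ℝ) * γ₂ n) atTop (𝓝 L₂) → 3 * Real.log 2 ≤ L₂ := by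
  intro γ₁ γ₂ h₁ hineq L₂ hL
  refine le_of_tendsto_of_tendsto arm5_tendsto_nMul_three_arm_lower hL ?_
  filter_upwards [eventually_ge_atTop 2] with n hn
  -- self-duality at width n and at width n - 1
  have hγa : Tendsto (rateSeqOne n) atTop (𝓝 (γ₁ n)) := h₁ n (by omega)
  have hγb : Tendsto (rateSeqOne (n - 1)) atTop (𝓝 (γ₁ (n - 1))) := h₁ (n - 1) (by omega)
  have ha : Real.log 2 / (n + 2) ≤ γ₁ n := rateOne_ge hγa
  have hb : Real.log 2 / (((n - 1 : ℕ) : ℝ) + 2) ≤ γ₁ (n - 1) := rateOne_ge hγb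
  have hcast : ((n - 1 : ℕ) : ℝ) + 2 = (n : ℝ) + 1 := by
    rw [Nat.cast_sub (by omega : 1 ≤ n)]; push_cast; ring
  rw [hcast] at hb
  have hi : 2 * γ₁ n + γ₁ (n - 1) ≤ γ₂ n := hineq n hn
  exact mul_le_mul_of_nonneg_left (by linarith) (by positivity)

end Summit.CriticalPhenomena.CardyFormulaZ2.Cruxes.StripClusterRates.TwoClusterRateIsStationaryGap

end
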